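import Mathlib.FieldTheory.IsAlgClosed.Basic
import Summits.HodgeConjecture.HodgeConjecture.Theorems.PadicSemiregularLiftSemiregularSeedsOnAnchorsDefs
import Summits.HodgeConjecture.HodgeConjecture.Theorems.PadicSemiregularLiftSemiregularSeedsOnAnchorsLinearCycleSupplyJacobian
import HarnessLib

/-!
# Stub S4a of line `gorenstein-ci-seeds`: linear-cycle supply at three-pair characters

LOG (worker of lead `prover-line-stmt-HodgeConjecture-13941-0`, crux stmt-HodgeConjecture-13941,
stub `stub_linearCycleSupply`):
* helpers `…LinearCycleSupplyHelpers` (pair forms `ℓ = x_u − ζ x_v`, cofactor `q`, `ℓ q = x_u^m +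
  x_v^m`, `pairDet = ∂_v q + ζ ∂_u q` and its coefficients, disjoint-variable coefficient lemma,
  `[−1] = −1` in `W(k)`), and `…LinearCycleSupplyJacobian` (block structure of the Jacobian,
  `det = ± ∏ pairDet`, visibility coefficient `≠ 0`, primality of `(ℓ_0, ℓ_1, ℓ_2)`): pure
  Mathlib, theorem-only, landed separately (Helpers: p84700, commit e87024354b7f; Jacobian: p86393, commit
  2e1ef0d0bbc7);
* this file: the registered stub `stub_linearCycleSupply`, exactly the statement
  `LinearCycleSupply` of the skeleton, over the Defs module of the line (no other declaration).

Crux `PadicSemiregularLift.SemiregularSeedsOnAnchors`, line `gorenstein-ci-seeds`, stub S4a. Over an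
algebraically closed field `k` of characteristic `p > 10` with `p ∤ m`, `m ≥ 3`, every admissible
THREE-PAIR character `a` of the Fermat fourfold `X⁴_m` (pairs `{σ(2t), σ(2t+1)}` with
`a_{σ(2t)} + a_{σ(2t+1)} = 0`) is reached by the LINEAR CYCLE `x_{σ(2t)} = ζ x_{σ(2t+1)}`
(`ζ^m = −1`): the CI-type datum `f_t = x_{σ(2t)} − ζ x_{σ(2t+1)}`,
`g_t = Σ_{i<m} x_{σ(2t)}^i (ζ x_{σ(2t+1)})^{m−1−i}` of the Fermat form (`Σ f_t g_t = Σ x_i^m`,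
`(f)` prime) is VISIBLE at `a` (the Jacobian of `(f, g)` is block diagonal with blocks
`[[1, −ζ], [∂_u g_t, ∂_v g_t]]`, so `P_Z = ± ∏_t (∂_v g_t + ζ ∂_u g_t) = ± m³ζ³ ∏_t Σ_{a+b=m−2}
ζ^b x_u^a x_v^b`, and `x^{a−1}` has pair sums `(val a_u − 1) + (val a_v − 1) = m − 2`, whence
coefficient `± m³ ζ^{…} ≠ 0`) and LIFTS to `W(k)` (same formulas with the Teichmüller lift `[ζ]`,
`[ζ]^m = [−1] = −1` as `p` is odd). Sources: T. Shioda, Math. Ann. 245 (1979) §1 (linear cycles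
carry the pair characters); H. Movasati, R. Villaflor Loyola, arXiv:1705.00084 (periods of linear
cycles, the case `d = 1`); R. Villaflor Loyola, arXiv:1812.03964, Thm 1 (`[Z]_prim ↔ det Jac(H)`).
-/

noncomputable section

-- the summit namespace `Summit.HodgeConjecture.HodgeConjecture.…` repeats a component by design
set_option linter.dupNamespace false

open MvPolynomial Literature.AlgebraicGeometry.Motives

universe u

namespace Summit.HodgeConjecture.HodgeConjecture.Theorems.SemiregularSeedsOnAnchors.GorensteinCiSeeds

open LinearCycle

/-- **Stub S4a** `stub_linearCycleSupply` (= `LinearCycleSupply` of the skeleton of line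
`gorenstein-ci-seeds`): at every admissible three-pair character of the Fermat fourfold `X⁴_m`
(`m ≥ 3`, `p > 10`, `p ∤ m`, `k` algebraically closed of characteristic `p`) there is a CI-type
datum of the Fermat form which is visible at the character and lifts to `W(k)` — the LINEAR datum
`d_t = 1`, `f_t = x_{σ(2t)} − ζ x_{σ(2t+1)}`, `g_t = Σ_{i<m} x_{σ(2t)}^i (ζ x_{σ(2t+1)})^{m−1−i}`
with `ζ^m = −1` (the linear cycle `x_{σ(2t)} = ζ x_{σ(2t+1)}`). [cite: Shioda1979HodgeFermat, §1] -/
theorem stub_linearCycleSupply :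
    ∀ (p : ℕ) [Fact p.Prime] (k : Type u) [Field k] [IsAlgClosed k] [CharP k p]
      (m : ℕ) (_ : 3 ≤ m) (_ : 10 < p) (_ : ¬ p ∣ m)
      (a : Fin 6 → ZMod m) (_ : IsAdmissible m a) (_ : IsThreePair m a),
      ∃ Z : CIDatum (fermatPolynomial k 4 m) m, Z.VisibleAt a ∧ Z.LiftsToWitt p := by
  intro p _ k _ _ _ m hm hp hpm a ha h3
  obtain ⟨σ, h01, h23, h45⟩ := h3
  obtain ⟨ζ, hζ⟩ := IsAlgClosed.exists_pow_nat_eq (-1 : k) (by omega : 0 < m)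
  haveI : NeZero m := ⟨by omega⟩
  have hζ0 : ζ ≠ 0 := by
    rintro rfl
    rw [zero_pow (by omega)] at hζ
    exact one_ne_zero (neg_eq_zero.mp hζ.symm)
  have hmk : (m : k) ≠ 0 := fun h => hpm ((CharP.cast_eq_zero_iff k p m).mp h)
  -- the linear datum: `f_t = x_{σ(2t)} − ζ x_{σ(2t+1)}`,
  -- `g_t = Σ_{i<m} x_{σ(2t)}^i (ζ x_{σ(2t+1)})^{m-1-i}`
  set f : Fin 3 → MvPolynomial (Fin 6) k :=
    fun t => X (σ (![0, 2, 4] t)) - C ζ * X (σ (![1, 3, 5] t)) with hf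
  set g : Fin 3 → MvPolynomial (Fin 6) k := fun t => ∑ i ∈ Finset.range m,
    X (σ (![0, 2, 4] t)) ^ i * (C ζ * X (σ (![1, 3, 5] t))) ^ (m - 1 - i) with hg
  let Z : CIDatum (fermatPolynomial k 4 m) m :=
    { d := fun _ => 1
      f := f
      g := g
      one_le_d := fun _ => le_rfl
      d_lt := fun _ => by omega
      f_hom := fun t => isHomogeneous_linForm _ _ ζ
      g_hom := fun t => isHomogeneous_geomForm _ _ ζ m
      f_ne := fun t h =>
        linF_mul_geomG_ne_zero σ hζ (by omega) t (by change f t * g t = 0; rw [h, zero_mul])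
      g_ne := fun t h =>
        linF_mul_geomG_ne_zero σ hζ (by omega) t (by change f t * g t = 0; rw [h, mul_zero])
      sum_eq := sum_linForm_mul_geomForm σ hζ
      radical := (isPrime_span_range_linF σ ζ hf).isRadical }
  refine ⟨Z, ?_, ?_⟩
  · -- VISIBILITY at `a`: the `x^{a−1}`-coefficient of `det (∂_j H_i) = ± ∏_t pd_t` is `± m³ ζ^{…}`
    change coeff (charExponent m a) (Matrix.of fun i j : Fin 6 =>
      pderiv j (Sum.elim f g ((@finSumFinEquiv 3 3).symm i))).det ≠ 0
    refine coeff_det_jac_ne_zero σ hζ0 (by omega) hmk hf hg (charExponent m a) fun t => ?_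
    simp only [charExponent, Finsupp.coe_equivFunOnFinite_symm]
    fin_cases t
    · exact val_pred_add_val_pred (ha.1 _) h01
    · exact val_pred_add_val_pred (ha.1 _) h23
    · exact val_pred_add_val_pred (ha.1 _) h45
  · -- LIFTABILITY to `W(k)`: the same formulas with the Teichmüller lift `[ζ]`, `[ζ]^m = [−1] = −1`
    set ζ' : WittVector p k := WittVector.teichmuller p ζ with hζ'
    have hζ'm : ζ' ^ m = -1 := by
      rw [hζ', ← map_pow, hζ, teichmuller_neg_one p k (by omega)]
    have hcc : (WittVector.constantCoeff : WittVector p k →+* k) ζ' = ζ := by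
      rw [WittVector.constantCoeff_apply, hζ', WittVector.teichmuller_coeff_zero]
    refine ⟨fun t => X (σ (![0, 2, 4] t)) - C ζ' * X (σ (![1, 3, 5] t)),
      fun t => ∑ i ∈ Finset.range m, X (σ (![0, 2, 4] t)) ^ i * (C ζ' * X (σ (![1, 3, 5] t))) ^
        (m - 1 - i),
      fun t => isHomogeneous_linForm _ _ ζ', fun t => isHomogeneous_geomForm _ _ ζ' m,
      sum_linForm_mul_geomForm σ hζ'm, fun t => ?_, fun t => ?_⟩
    · change MvPolynomial.map _ _ = f t
      rw [map_linForm, hcc]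
    · change MvPolynomial.map _ _ = g t
      rw [map_geomForm, hcc]

end Summit.HodgeConjecture.HodgeConjecture.Theorems.SemiregularSeedsOnAnchors.GorensteinCiSeeds

end
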